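import Summits.ValiantsHypothesis.ValiantsHypothesis.Theorems.NewtonUnitEquationsTwoProductsRaySplitDefs

/-!
# Line `relation_ladder` — rung R11 «freiman-ray-split», Stage 1: the RUNG STATEMENT of record (Cruxes sketch, no stubs, no sorry)

Cruxes record written by the 5906 pen (val-port-1 g2→g3; desk g13 RULINGS #316/#317/#318/#325, director R282 (7)(b)).  ONE SOURCE OF TRUTH: the
definitions `IndepRays`, `OnRays`, `raySum`, `RayCrossFree` and the laws `RaySplitLaw` / `RaySplitCellLaw` live in the Theorems module
`…Theorems.NewtonUnitEquations.TwoProducts.RaySplit` (`Theorems/NewtonUnitEquationsTwoProductsRaySplitDefs.lean`, texts = val-idea-32 g0's card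
`Cruxes/TwoProducts/Ideas/freiman-ray-split.md` ll. 46–52 verbatim, critic of record val-idea-crit-8); this file only RE-EXPORTS them by name so that
a future `relation_ladder` v22 can register `stub_raySplit : R11Rung := <the Stage-1 prover's theorem>` by δ.
SCOPE LABEL: a proper POSITIVE SUB-CASE rung (K independent rays, ray-cross-free letter families; t-free count `2^((m+1)K)` with K in the
exponent), NOT the residual `ResidualLawV21`; nothing here closes 5906; VP ≠ VNP is NOT proved.
-/

set_option linter.dupNamespace false

namespace Summit.ValiantsHypothesis.ValiantsHypothesis.Cruxes.TwoProducts.RelationLadder.R11Sketch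

/-- **R11 rung, cell currency** (the form `relation_ladder` consumes): `RaySplit.RaySplitCellLaw`, by name. -/
def R11Rung : Prop :=
  Summit.ValiantsHypothesis.ValiantsHypothesis.Theorems.NewtonUnitEquations.TwoProducts.RaySplit.RaySplitCellLaw

/-- **R11 rung, visible-count currency**: `RaySplit.RaySplitLaw`, by name. -/
def R11RungVisible : Prop :=
  Summit.ValiantsHypothesis.ValiantsHypothesis.Theorems.NewtonUnitEquations.TwoProducts.RaySplit.RaySplitLaw

/-- The two currencies unfold definitionally to the Theorems laws. -/
theorem r11Rung_iff : R11Rung ↔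
    Summit.ValiantsHypothesis.ValiantsHypothesis.Theorems.NewtonUnitEquations.TwoProducts.RaySplit.RaySplitCellLaw := Iff.rfl

end Summit.ValiantsHypothesis.ValiantsHypothesis.Cruxes.TwoProducts.RelationLadder.R11Sketch
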